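import Literature.Geometry.Lorentzian.KerrDataSchwarzschildMetric
import Literature.Geometry.Lorentzian.ChartSecondFundamentalForm
import Literature.Geometry.Lorentzian.KerrSchildCoord
import HarnessLib

/-!
# The Schwarzschild (`a = 0`) Kerr–Schild slice data in closed form, II: the second
# fundamental form

Support file (all results proved, no named facts), continuing
`KerrDataSchwarzschildMetric.lean`, for the verification that the Schwarzschild initial data
`Kerr.data M 0 r₀` solve the vacuum constraints (the `a = 0` instance of the named fact
`Kerr.data_isVacuumConstraintSolution`; Choquet-Bruhat 2009, Ch. VI, Thm. 3.3; Cook, Living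
Rev. Relativ. 3 (2000) 5, §3.2.2, (56)–(57)).

**Main result** (`Kerr.data_k_zero_apply`): the tensor `k = K_ν` of `Kerr.data M 0 r₀` — the
second fundamental form of the slice `{t* = 0}` of Schwarzschild in ingoing Kerr–Schild
coordinates with respect to the future unit normal `ν = (1 + 2H)^{-1/2} (1 + 2H, −2H y/r)`,
sign convention `K_ν(v, w) = + g(D_v ν, df w)` — is

  `k_y(v, w) = −(2M / (r² √(1 + 2M/r))) (⟪v, w⟫ − (2 + M/r) ⟪y, v⟫⟪y, w⟫ / r²)`,  `r = ‖y‖`,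

i.e. `K_ij = −(2Mα/r²)(δ_ij − (2 + M/r) nᵢ nⱼ)`, `α = (1 + 2M/r)^{-1/2}`, `n = y/r` (Cook 2000,
(57), up to the overall sign fixed by the conventions (h) of the tree: future normal, `+g(D_v ν, ·)`).

Steps (the coordinate formula `K_ν(v, w) = g(DN v + Γ(N)(DΦ v), DΦ w)` for maps between chart
domains is `OpensChart.secondFundamentalForm_eq_of_repr`, file `ChartSecondFundamentalForm.lean`):
* `Kerr.bilinZero`, `Kerr.bilin_zero_eq_bilinZero` — for `a = 0` and off the axis `{x⃗ = 0}` the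
  Kerr–Schild components are `g = η + (2M/|x⃗|) ℓ ⊗ ℓ`, `ℓ(A) = A⁰ + ⟪x⃗, A⃗⟫/|x⃗|`;
  `Kerr.hasFDerivAt_bilinZero`, `Kerr.fderiv_bilin_zero_apply` — **their first derivatives**
  `(∂_U g)(A, B) = (∂_U 2H) ℓ(A)ℓ(B) + 2H ((∂_U ℓ)(A) ℓ(B) + ℓ(A) (∂_U ℓ)(B))` with
  `∂_U H = −M ⟪x⃗, U⃗⟫/|x⃗|³`, `(∂_U ℓ)(A) = ⟪U⃗, A⃗⟫/|x⃗| − ⟪x⃗, U⃗⟫⟪x⃗, A⃗⟫/|x⃗|³`;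
* `Kerr.timeVector_zero_ofTimeSpace`, `Kerr.sliceNormalRep_eq`, `Kerr.differentiableAt_sliceNormalRep`,
  `Kerr.bilin_fderiv_sliceNormalRep` — the future unit normal `N = (1+2H)^{-1/2}((1+2H)∂_{t*} −
  (2M/r²)(0, y))` in closed form, its differentiability (`M ≥ 0`), and the derivative of the
  normality relation `g(N, w̃) = 0` along the slice: `g(DN v, w̃) = −(∂_ṽ g)(N, w̃)`;
* `Kerr.secondFundamentalForm_zero_eq_half` — `K_N(v, w) = ½ ((∂_N g)(w̃, ṽ) − (∂_ṽ g)(N, w̃) −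
  (∂_w̃ g)(ṽ, N))`, `ṽ = (0, v)`, from `K = g(DN v + Γ(N)(ṽ), w̃)` and the first-kind Christoffel
  symbols `g(Γ(Z)(Y), W) = ½ K(Z, Y, W)` (`val_christoffel_const`);
* `Kerr.data_k_zero_apply` — the closed form above (`kRep`).

Everything is proved; the definitions (`nullCovectorZero`, `bilinZero`, their derivative maps,
`sliceEmbedCLM`, `sliceNormalRep`, `kRep`) are explicit closed-form expressions, no named facts.

## References

* G. B. Cook, *Initial data for numerical relativity*, Living Rev. Relativ. 3 (2000) 5, §3.2.2,
  (56)–(57).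
* B. O'Neill, *Semi-Riemannian geometry* (1983), Ch. 3, Prop. 3.13; Ch. 4, Lemma 4.1,
  Lemma 4.4 ff.
* R. M. Wald, *General Relativity* (1984), (10.2.13).
* Y. Choquet-Bruhat, *General Relativity and the Einstein Equations* (2009), Ch. VI, Thm. 3.3.
-/

noncomputable section

-- instance search through the nested operator types `E4 →L E4 →L E4 →L ℝ` (as in `ChartCurvature`)
set_option maxSynthPendingDepth 3

open Bundle TopologicalSpace Manifold Set Module
open scoped ContDiff Topology InnerProductSpace

namespace Literature.Geometry.Lorentzian


/-! ### The Kerr–Schild components at `a = 0` off the axis, and their first derivatives -/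

namespace Kerr

/-- The Kerr–Schild covector at `a = 0` as a function on `E4` off the time axis:
`ℓ(A) = A⁰ + ⟪x⃗, A⃗⟫ / |x⃗|` (`ℓ = (1, x⃗/r)`, `r = |x⃗|`; junk value `dt` on the axis).
Visser arXiv:0706.0622, (34) with `a = 0`. [cite: arXiv07060622, (34)] -/
def nullCovectorZero (x : E4) : E4 →L[ℝ] ℝ :=
  E4.dx 0 + ‖E4.spatial x‖⁻¹ • (E3.covec (E4.spatial x)).comp E4.spatial

/-- `nullCovectorZero x A = A 0 + ⟪x⃗, A⃗⟫ / |x⃗|`. [cite: arXiv07060622, (34)] -/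
@[simp]
theorem nullCovectorZero_apply (x A : E4) :
    nullCovectorZero x A = A 0 + ‖E4.spatial x‖⁻¹ * ⟪E4.spatial x, E4.spatial A⟫_ℝ := by
  simp [nullCovectorZero]

/-- The Kerr–Schild components at `a = 0` as a function on `E4` off the time axis:
`g = η + (2M/|x⃗|) ℓ ⊗ ℓ`. Visser arXiv:0706.0622, (32)–(34) with `a = 0` (Schwarzschild in
ingoing Eddington–Finkelstein/Kerr–Schild form). [cite: arXiv07060622, (32)–(34)] -/
def bilinZero (M : ℝ) (x : E4) : E4 →L[ℝ] E4 →L[ℝ] ℝ :=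
  Minkowski.bilin + (2 * M / ‖E4.spatial x‖) • (nullCovectorZero x).smulRight (nullCovectorZero x)

/-- `bilinZero M x A B = η(A, B) + (2M/|x⃗|) ℓ(A) ℓ(B)`. [cite: arXiv07060622, (32)–(34)] -/
theorem bilinZero_apply (M : ℝ) (x A B : E4) :
    bilinZero M x A B = Minkowski.bilin A B +
      2 * M / ‖E4.spatial x‖ * (nullCovectorZero x A * nullCovectorZero x B) := by
  simp only [bilinZero, add_apply, FunLike.coe_smul, Pi.smul_apply,
    ContinuousLinearMap.smulRight_apply, smul_eq_mul]

/-- For `a = 0` the Kerr–Schild radius is the spatial norm `|x⃗|`. [cite: arXiv08110354, §5.1] -/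
theorem radius_zero_eq_norm_spatial (x : E4) : radius 0 x = ‖E4.spatial x‖ := radius_zero_left x

/-- Off the axis, `H(x) = M / |x⃗|` for `a = 0`. [cite: arXiv07060622, (33)] -/
theorem scalarH_zero (M : ℝ) {x : E4} (hx : E4.spatial x ≠ 0) : scalarH M 0 x = M / ‖E4.spatial x‖ := by
  have hr : ‖E4.spatial x‖ ≠ 0 := norm_ne_zero_iff.2 hx
  rw [scalarH, radius_zero_eq_norm_spatial]
  field_simp
  ring

/-- Off the axis, the Kerr–Schild covector at `a = 0` is `nullCovectorZero`. [cite: arXiv07060622, (34)] -/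
theorem nullCovector_zero_eq (x : E4) (hx : E4.spatial x ≠ 0) :
    nullCovector 0 x = nullCovectorZero x := by
  have hr : ‖E4.spatial x‖ ≠ 0 := norm_ne_zero_iff.2 hx
  ext A
  rw [nullCovector, E4.covector_apply, Fin.sum_univ_four, nullCovectorZero_apply]
  simp only [nullCovectorFun, radius_zero_eq_norm_spatial, Fin.isValue, Matrix.cons_val_zero,
    one_mul, Matrix.cons_val_one, Matrix.cons_val]
  have hin : ⟪E4.spatial x, E4.spatial A⟫_ℝ = x 1 * A 1 + x 2 * A 2 + x 3 * A 3 := by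
    simp [PiLp.inner_apply, Fin.sum_univ_three, mul_comm]
  rw [hin]
  field_simp
  ring

/-- **The Schwarzschild Kerr–Schild components off the axis**: for `a = 0` and `x⃗ ≠ 0`,
`Kerr.bilin M 0 x = η + (2M/|x⃗|) ℓ ⊗ ℓ = bilinZero M x`. [cite: arXiv07060622, (32)–(34)] -/
theorem bilin_zero_eq_bilinZero (M : ℝ) {x : E4} (hx : E4.spatial x ≠ 0) :
    bilin M 0 x = bilinZero M x := by
  ext A B
  rw [bilin_apply, bilinZero_apply, scalarH_zero M hx, nullCovector_zero_eq x hx]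
  ring

/-- Near a point off the axis, `Kerr.bilin M 0` and `bilinZero M` agree (as germs). [folklore] -/
theorem bilin_zero_eventuallyEq (M : ℝ) {x : E4} (hx : E4.spatial x ≠ 0) :
    bilin M 0 =ᶠ[𝓝 x] bilinZero M := by
  have ho : IsOpen {x : E4 | E4.spatial x ≠ 0} := isOpen_ne_fun E4.spatial.continuous continuous_const
  filter_upwards [ho.mem_nhds hx] with z hz
  exact bilin_zero_eq_bilinZero M hz

/-- The continuous linear map `s ↦ ⟪s, ·⃗⟫ = ⟪s, ·⟫ ∘ spatial`, `E3 →L (E4 →L ℝ)`. [folklore] -/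
def covecSpatial : E3 →L[ℝ] E4 →L[ℝ] ℝ :=
  ((ContinuousLinearMap.compL ℝ E4 E3 ℝ).flip E4.spatial).comp E3.delta

/-- `covecSpatial s A = ⟪s, A⃗⟫`. [folklore] -/
@[simp]
theorem covecSpatial_apply (s : E3) (A : E4) : covecSpatial s A = ⟪s, E4.spatial A⟫_ℝ := by
  simp [covecSpatial, ContinuousLinearMap.compL_apply, ContinuousLinearMap.flip_apply]

/-- `covecSpatial s = ⟪s, ·⟫ ∘ spatial`. [folklore] -/
theorem covecSpatial_eq (s : E3) : covecSpatial s = (E3.covec s).comp E4.spatial := by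
  ext A; simp

/-- The derivative of the Kerr–Schild covector at `a = 0`, as a continuous linear map
`E4 →L (E4 →L ℝ)`: `U ↦ |x⃗|⁻¹ ⟪U⃗, ·⃗⟫ − |x⃗|⁻³ ⟪x⃗, U⃗⟫ ⟪x⃗, ·⃗⟫`. [cite: arXiv07060622, (34)] -/
def nullCovectorZeroDeriv (x : E4) : E4 →L[ℝ] E4 →L[ℝ] ℝ :=
  ‖E4.spatial x‖⁻¹ • covecSpatial.comp E4.spatial +
    (((-(1 : ℝ)) / ‖E4.spatial x‖ ^ 3) • (E3.covec (E4.spatial x)).comp E4.spatial).smulRight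
      (covecSpatial (E4.spatial x))

/-- `(∂_U ℓ)(A) = |x⃗|⁻¹ ⟪U⃗, A⃗⟫ − |x⃗|⁻³ ⟪x⃗, U⃗⟫ ⟪x⃗, A⃗⟫`. [cite: arXiv07060622, (34)] -/
@[simp]
theorem nullCovectorZeroDeriv_apply (x U A : E4) :
    nullCovectorZeroDeriv x U A = ‖E4.spatial x‖⁻¹ * ⟪E4.spatial U, E4.spatial A⟫_ℝ +
      (-1) / ‖E4.spatial x‖ ^ 3 * ⟪E4.spatial x, E4.spatial U⟫_ℝ *
        ⟪E4.spatial x, E4.spatial A⟫_ℝ := by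
  simp only [nullCovectorZeroDeriv, add_apply, FunLike.coe_smul, Pi.smul_apply, smul_eq_mul,
    ContinuousLinearMap.smulRight_apply, ContinuousLinearMap.comp_apply, covecSpatial_apply,
    E3.covec_apply]

/-- **Differentiability of the Kerr–Schild covector at `a = 0` off the axis**, with derivative
`nullCovectorZeroDeriv x`. [cite: arXiv07060622, (34)] -/
theorem hasFDerivAt_nullCovectorZero {x : E4} (hx : E4.spatial x ≠ 0) :
    HasFDerivAt nullCovectorZero (nullCovectorZeroDeriv x) x := by
  have h1 : HasFDerivAt (fun x : E4 ↦ (‖E4.spatial x‖ ^ 1)⁻¹)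
      (((-(1 : ℕ) : ℝ) / ‖E4.spatial x‖ ^ (1 + 2)) • E3.covec (E4.spatial x) ∘L E4.spatial) x :=
    (hasFDerivAt_inv_norm_pow hx 1).comp x E4.spatial.hasFDerivAt
  have h2 : HasFDerivAt (fun x : E4 ↦ covecSpatial (E4.spatial x)) (covecSpatial.comp E4.spatial) x :=
    covecSpatial.hasFDerivAt.comp x E4.spatial.hasFDerivAt
  have h := (h1.smul h2).const_add (E4.dx 0)
  have hfun : nullCovectorZero = fun x : E4 ↦ E4.dx 0 +
      (‖E4.spatial x‖ ^ 1)⁻¹ • covecSpatial (E4.spatial x) := by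
    funext z
    rw [nullCovectorZero, pow_one, covecSpatial_eq]
  rw [hfun]
  refine h.congr_fderiv ?_
  ext U A
  simp only [nullCovectorZeroDeriv_apply, add_apply, FunLike.coe_smul, Pi.smul_apply, smul_eq_mul,
    ContinuousLinearMap.smulRight_apply, ContinuousLinearMap.comp_apply, covecSpatial_apply,
    E3.covec_apply]
  push_cast
  ring

/-- The derivative of the Schwarzschild Kerr–Schild components `bilinZero M` off the axis, as a
continuous linear map `E4 →L (E4 →L E4 →L ℝ)` (Leibniz rule for `(2M/|x⃗|) ℓ ⊗ ℓ`).
[cite: arXiv07060622, (32)–(34)] -/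
def bilinZeroDeriv (M : ℝ) (x : E4) : E4 →L[ℝ] E4 →L[ℝ] E4 →L[ℝ] ℝ :=
  (2 * M / ‖E4.spatial x‖) •
      ((ContinuousLinearMap.smulRightL ℝ E4 (E4 →L[ℝ] ℝ)).precompR E4 (nullCovectorZero x)
          (nullCovectorZeroDeriv x) +
        (ContinuousLinearMap.smulRightL ℝ E4 (E4 →L[ℝ] ℝ)).precompL E4 (nullCovectorZeroDeriv x)
          (nullCovectorZero x)) +
    (((-(2 * M)) / ‖E4.spatial x‖ ^ 3) • (E3.covec (E4.spatial x)).comp E4.spatial).smulRight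
      ((nullCovectorZero x).smulRight (nullCovectorZero x))

/-- **The first derivatives of the Schwarzschild Kerr–Schild components**:
`(∂_U g)(A, B) = (2M/|x⃗|) (ℓ(A) (∂_U ℓ)(B) + (∂_U ℓ)(A) ℓ(B)) − (2M/|x⃗|³) ⟪x⃗, U⃗⟫ ℓ(A) ℓ(B)`
(`∂_U (2M/|x⃗|) = −2M ⟪x⃗, U⃗⟫/|x⃗|³`). [cite: arXiv07060622, (32)–(34)] -/
@[simp]
theorem bilinZeroDeriv_apply (M : ℝ) (x U A B : E4) :
    bilinZeroDeriv M x U A B =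
      2 * M / ‖E4.spatial x‖ * (nullCovectorZero x A * nullCovectorZeroDeriv x U B +
          nullCovectorZeroDeriv x U A * nullCovectorZero x B) +
        (-(2 * M)) / ‖E4.spatial x‖ ^ 3 * ⟪E4.spatial x, E4.spatial U⟫_ℝ *
          (nullCovectorZero x A * nullCovectorZero x B) := by
  simp only [bilinZeroDeriv, add_apply, FunLike.coe_smul, Pi.smul_apply, smul_eq_mul,
    ContinuousLinearMap.smulRight_apply, ContinuousLinearMap.comp_apply, E3.covec_apply,
    ContinuousLinearMap.precompR_apply, ContinuousLinearMap.precompL_apply,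
    ContinuousLinearMap.compL_apply, ContinuousLinearMap.smulRightL_apply_apply]

/-- **Differentiability of the Schwarzschild Kerr–Schild components off the axis**, with
derivative `bilinZeroDeriv M x`. [cite: arXiv07060622, (32)–(34)] -/
theorem hasFDerivAt_bilinZero (M : ℝ) {x : E4} (hx : E4.spatial x ≠ 0) :
    HasFDerivAt (bilinZero M) (bilinZeroDeriv M x) x := by
  have hc : HasFDerivAt (fun x : E4 ↦ 2 * M / ‖E4.spatial x‖ ^ 1)
      (((-(2 * M * (1 : ℕ))) / ‖E4.spatial x‖ ^ (1 + 2)) • E3.covec (E4.spatial x) ∘L E4.spatial) x :=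
    (hasFDerivAt_const_div_norm_pow (2 * M) hx 1).comp x E4.spatial.hasFDerivAt
  have hl := hasFDerivAt_nullCovectorZero hx
  have ht := (ContinuousLinearMap.smulRightL ℝ E4 (E4 →L[ℝ] ℝ)).hasFDerivAt_of_bilinear hl hl
  have h := (hc.smul ht).const_add Minkowski.bilin
  have hfun : bilinZero M = fun x : E4 ↦ Minkowski.bilin + (2 * M / ‖E4.spatial x‖ ^ 1) •
      ContinuousLinearMap.smulRightL ℝ E4 (E4 →L[ℝ] ℝ) (nullCovectorZero x) (nullCovectorZero x) := by
    funext z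
    rw [bilinZero, pow_one]
    rfl
  rw [hfun]
  refine h.congr_fderiv ?_
  ext U A B
  simp only [bilinZeroDeriv_apply, add_apply, FunLike.coe_smul, Pi.smul_apply, smul_eq_mul,
    ContinuousLinearMap.smulRight_apply, ContinuousLinearMap.comp_apply, E3.covec_apply,
    ContinuousLinearMap.precompR_apply, ContinuousLinearMap.precompL_apply,
    ContinuousLinearMap.compL_apply, ContinuousLinearMap.smulRightL_apply_apply]
  push_cast
  ring

/-- **The first derivatives of the Schwarzschild Kerr–Schild metric `Kerr.bilin M 0` off the
axis** are those of `bilinZero M`: `fderiv (Kerr.bilin M 0) x U A B = bilinZeroDeriv M x U A B`.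
[cite: arXiv07060622, (32)–(34)] -/
theorem fderiv_bilin_zero_apply (M : ℝ) {x : E4} (hx : E4.spatial x ≠ 0) (U A B : E4) :
    fderiv ℝ (bilin M 0) x U A B = bilinZeroDeriv M x U A B := by
  rw [(bilin_zero_eventuallyEq M hx).fderiv_eq, (hasFDerivAt_bilinZero M hx).fderiv]

/-- `Kerr.bilin M 0` has derivative `bilinZeroDeriv M x` off the axis. [cite: arXiv07060622, (32)–(34)] -/
theorem hasFDerivAt_bilin_zero (M : ℝ) {x : E4} (hx : E4.spatial x ≠ 0) :
    HasFDerivAt (bilin M 0) (bilinZeroDeriv M x) x :=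
  (hasFDerivAt_bilinZero M hx).congr_of_eventuallyEq (bilin_zero_eventuallyEq M hx)

/-! ### The slice embedding and the future unit normal at `a = 0` -/

/-- The slice map `y ↦ (0, y)` as a continuous linear map `E3 →L E4`. [folklore] -/
def sliceEmbedCLM : E3 →L[ℝ] E4 :=
  LinearMap.toContinuousLinearMap (IsLinearMap.mk' (E4.ofTimeSpace 0) (by
    constructor
    · intro y y'
      ext i
      refine Fin.cases ?_ (fun j ↦ ?_) i <;> simp
    · intro c y
      ext i
      refine Fin.cases ?_ (fun j ↦ ?_) i <;> simp))

/-- `sliceEmbedCLM y = (0, y)`. [folklore] -/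
@[simp]
theorem sliceEmbedCLM_apply (y : E3) : sliceEmbedCLM y = E4.ofTimeSpace 0 y := rfl

/-- `y ↦ (0, y)` is its own derivative. [folklore] -/
theorem hasFDerivAt_ofTimeSpace_zero (y : E3) : HasFDerivAt (E4.ofTimeSpace 0) sliceEmbedCLM y :=
  sliceEmbedCLM.hasFDerivAt

/-- `D(y ↦ (0, y)) v = (0, v)`. [folklore] -/
theorem fderiv_ofTimeSpace_zero (y v : E3) : fderiv ℝ (E4.ofTimeSpace 0) y v = E4.ofTimeSpace 0 v := by
  rw [(hasFDerivAt_ofTimeSpace_zero y).fderiv, sliceEmbedCLM_apply]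

/-- The spatial part of `∂_{t*}` vanishes. [folklore] -/
@[simp]
theorem spatial_basisVector_zero : E4.spatial (E4.basisVector 0) = 0 := by
  ext i
  simp [E4.spatial_apply, Fin.succ_ne_zero]

/-- `∂_{t*}` has time component `1`. [folklore] -/
@[simp]
theorem basisVector_zero_apply_zero : E4.basisVector 0 0 = 1 := by
  simp

/-- **The vector `V = −g♯(dt*)` on the slice for `a = 0`**: at `(0, y)`, `y ≠ 0`,
`V = (1 + 2M/r) ∂_{t*} − (2M/r²) (0, y)` (`V = (1 + 2H, −2H y/r)`, `H = M/r`).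
Dafermos–Rodnianski arXiv:0811.0354, §5.1; Cook 2000, §3.2.2 (shift `βⁱ = 2Hℓⁱ/(1+2H)`).
[cite: Cook2000, §3.2.2] -/
theorem timeVector_zero_ofTimeSpace (M : ℝ) {y : E3} (hy : y ≠ 0) :
    timeVector M 0 (E4.ofTimeSpace 0 y) =
      (1 + 2 * M / ‖y‖) • E4.basisVector 0 - (2 * M / ‖y‖ ^ 2) • E4.ofTimeSpace 0 y := by
  have hr : ‖y‖ ≠ 0 := norm_ne_zero_iff.2 hy
  rw [timeVector, scalarH_zero_ofTimeSpace M hy, nullVector_eq]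
  ext μ
  refine Fin.cases ?_ (fun j ↦ ?_) μ
  · simp [nullCovectorFun]
    ring
  · fin_cases j
    · simp [nullCovectorFun, radius_zero_ofTimeSpace]
      field_simp
    · simp [nullCovectorFun, radius_zero_ofTimeSpace]
      field_simp
    · simp [nullCovectorFun, radius_zero_ofTimeSpace]
      field_simp

/-- **The future unit normal of the Schwarzschild slice as a function on `E3`**:
`N(y) = (1 + 2H)^{-1/2} V(0, y)`, the representative of `Kerr.sliceNormal M 0 r₀`
(`sliceNormal_apply`). Cook 2000, §3.2.2 (lapse `α = (1 + 2H)^{-1/2}`). [cite: Cook2000, §3.2.2] -/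
def sliceNormalRep (M : ℝ) (y : E3) : E4 :=
  (√(1 + 2 * scalarH M 0 (E4.ofTimeSpace 0 y)))⁻¹ • timeVector M 0 (E4.ofTimeSpace 0 y)

/-- `Kerr.sliceNormal M 0 r₀ y = sliceNormalRep M y`. [cite: Cook2000, §3.2.2] -/
theorem sliceNormal_zero_eq (M r₀ : ℝ) : ∀ y : slice 0 r₀, sliceNormal M 0 r₀ y = sliceNormalRep M y :=
  fun _ ↦ rfl

/-- **The unit normal in closed form**: for `y ≠ 0`,
`N(y) = (1 + 2M/r)^{-1/2} ((1 + 2M/r) ∂_{t*} − (2M/r²) (0, y))`. [cite: Cook2000, §3.2.2] -/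
theorem sliceNormalRep_eq (M : ℝ) {y : E3} (hy : y ≠ 0) :
    sliceNormalRep M y = (√(1 + 2 * M / ‖y‖))⁻¹ •
      ((1 + 2 * M / ‖y‖) • E4.basisVector 0 - (2 * M / ‖y‖ ^ 2) • E4.ofTimeSpace 0 y) := by
  rw [sliceNormalRep, scalarH_zero_ofTimeSpace M hy, timeVector_zero_ofTimeSpace M hy,
    mul_div_assoc]

/-- The time component of the unit normal: `N⁰ = √(1 + 2M/r)⁻¹ (1 + 2M/r)`. [cite: Cook2000, §3.2.2] -/
theorem sliceNormalRep_apply_zero (M : ℝ) {y : E3} (hy : y ≠ 0) :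
    sliceNormalRep M y 0 = (√(1 + 2 * M / ‖y‖))⁻¹ * (1 + 2 * M / ‖y‖) := by
  rw [sliceNormalRep_eq M hy]
  simp

/-- The spatial part of the unit normal: `N⃗ = −√(1 + 2M/r)⁻¹ (2M/r²) y` (minus the
normalised shift). [cite: Cook2000, §3.2.2] -/
theorem spatial_sliceNormalRep (M : ℝ) {y : E3} (hy : y ≠ 0) :
    E4.spatial (sliceNormalRep M y) = -((√(1 + 2 * M / ‖y‖))⁻¹ * (2 * M / ‖y‖ ^ 2)) • y := by
  rw [sliceNormalRep_eq M hy]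
  simp only [map_smul, map_sub, spatial_basisVector_zero, E4.spatial_ofTimeSpace, smul_zero,
    zero_sub, smul_neg, smul_smul, neg_smul]

/-- **The unit normal is differentiable** at the points of the slice, for `M ≥ 0` (`H`, `V` are
analytic off the axis, `KerrSchildCoord.lean`, and `1 + 2H > 0`). [cite: Cook2000, §3.2.2] -/
theorem differentiableAt_sliceNormalRep {M : ℝ} (hM : 0 ≤ M) {y : E3} (hy : y ≠ 0) :
    DifferentiableAt ℝ (sliceNormalRep M) y := by
  have hx : 0 < radius 0 (E4.ofTimeSpace 0 y) := by
    rw [radius_zero_ofTimeSpace]; exact norm_pos_iff.2 hy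
  have he : ContDiff ℝ 1 (E4.ofTimeSpace 0) := contMDiff_iff_contDiff.1 (E4.contMDiff_ofTimeSpace 0 1)
  have hH : ContDiffAt ℝ 1 (fun y : E3 ↦ scalarH M 0 (E4.ofTimeSpace 0 y)) y :=
    (contDiffAt_scalarH M 0 hx).comp y he.contDiffAt
  have hV : ContDiffAt ℝ 1 (fun y : E3 ↦ timeVector M 0 (E4.ofTimeSpace 0 y)) y :=
    (contDiffAt_timeVector M 0 hx).comp y he.contDiffAt
  have hpos : 1 + 2 * scalarH M 0 (E4.ofTimeSpace 0 y) ≠ 0 := by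
    have := scalarH_nonneg hM 0 (E4.ofTimeSpace 0 y); positivity
  have hs : ContDiffAt ℝ 1 (fun y : E3 ↦ (√(1 + 2 * scalarH M 0 (E4.ofTimeSpace 0 y)))⁻¹) y := by
    refine ((contDiffAt_const.add (contDiffAt_const.mul hH)).sqrt hpos).inv ?_
    exact (Real.sqrt_pos.2 (by have := scalarH_nonneg hM 0 (E4.ofTimeSpace 0 y); positivity)).ne'
  exact (hs.smul hV).differentiableAt one_ne_zero

/-- **Normality**: `g(N(y), (0, w)) = 0` at `(0, y)`, `y ≠ 0` (`g(V, ·) = −dt*`).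
Dafermos–Rodnianski arXiv:0811.0354, §5.1. [cite: arXiv08110354, §5.1] -/
theorem bilin_sliceNormalRep_ofTimeSpace (M : ℝ) {y : E3} (hy : y ≠ 0) (w : E3) :
    bilin M 0 (E4.ofTimeSpace 0 y) (sliceNormalRep M y) (E4.ofTimeSpace 0 w) = 0 := by
  have hx : 0 < radius 0 (E4.ofTimeSpace 0 y) := by
    rw [radius_zero_ofTimeSpace]; exact norm_pos_iff.2 hy
  rw [sliceNormalRep, map_smul, smul_apply, bilin_timeVector hx, E4.ofTimeSpace_apply_zero,
    neg_zero, smul_zero]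

/-- **The derivative of the normality relation along the slice**: for `y ≠ 0` (and `M ≥ 0`),
`g(DN(y) v, (0, w)) = −(∂_{(0,v)} g)(N(y), (0, w))` at `(0, y)` — differentiate
`y ↦ g_{(0,y)}(N(y), (0, w)) ≡ 0`. O'Neill 1983, Ch. 4, proof of Lemma 4.4 (differentiating
`⟨Z, W⟩ = 0` for `Z` normal, `W` tangent). [cite: ONeill1983, Ch. 4, Lemma 4.4] -/
theorem bilin_fderiv_sliceNormalRep {M : ℝ} (hM : 0 ≤ M) {y : E3} (hy : y ≠ 0) (v w : E3) :
    bilin M 0 (E4.ofTimeSpace 0 y) (fderiv ℝ (sliceNormalRep M) y v) (E4.ofTimeSpace 0 w) =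
      -fderiv ℝ (bilin M 0) (E4.ofTimeSpace 0 y) (E4.ofTimeSpace 0 v) (sliceNormalRep M y)
        (E4.ofTimeSpace 0 w) := by
  have hsp : E4.spatial (E4.ofTimeSpace 0 y) ≠ 0 := by rwa [E4.spatial_ofTimeSpace]
  -- the function `y' ↦ g_{(0,y')}(N y', (0,w))` vanishes near `y`
  have hzero : (fun y' : E3 ↦ bilin M 0 (E4.ofTimeSpace 0 y') (sliceNormalRep M y')
      (E4.ofTimeSpace 0 w)) =ᶠ[𝓝 y] fun _ ↦ 0 := by
    filter_upwards [isOpen_ne.mem_nhds hy] with y' hy'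
    exact bilin_sliceNormalRep_ofTimeSpace M hy' w
  have h0 : HasFDerivAt (fun y' : E3 ↦ bilin M 0 (E4.ofTimeSpace 0 y') (sliceNormalRep M y')
      (E4.ofTimeSpace 0 w)) (0 : E3 →L[ℝ] ℝ) y :=
    (hasFDerivAt_const (0 : ℝ) y).congr_of_eventuallyEq hzero
  -- and its derivative by the product rule
  have hB : HasFDerivAt (fun y' : E3 ↦ bilin M 0 (E4.ofTimeSpace 0 y'))
      ((bilinZeroDeriv M (E4.ofTimeSpace 0 y)).comp sliceEmbedCLM) y :=
    (hasFDerivAt_bilin_zero M hsp).comp y (hasFDerivAt_ofTimeSpace_zero y)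
  have hN := (differentiableAt_sliceNormalRep hM hy).hasFDerivAt
  have h1 := (hB.clm_apply hN).clm_apply (hasFDerivAt_const (E4.ofTimeSpace 0 w) y)
  have huniq := h0.unique h1
  have key := DFunLike.congr_fun huniq v
  simp only [zero_apply, add_apply, ContinuousLinearMap.comp_apply,
    ContinuousLinearMap.flip_apply, sliceEmbedCLM_apply, map_zero, zero_add] at key
  rw [fderiv_bilin_zero_apply M hsp]
  linarith

/-! ### The second fundamental form of the Schwarzschild slice -/

/-- **The second fundamental form of the Schwarzschild Kerr–Schild slice, closed form** (as a
function on `E3`): `kRep M y v w = −(2M / (r² √(1 + 2M/r))) (⟪v, w⟫ − (2 + M/r) ⟪y, v⟫⟪y, w⟫/r²)`,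
i.e. `K_ij = −(2Mα/r²)(δ_ij − (2 + M/r) nᵢnⱼ)`, `α = (1 + 2M/r)^{-1/2}`. Cook 2000, §3.2.2,
(57) (up to the overall sign fixed by the tree's conventions: future normal, `K(v,w) = +g(D_v ν, df w)`).
[cite: Cook2000, §3.2.2 (57)] -/
def kRep (M : ℝ) (y v w : E3) : ℝ :=
  -(2 * M / (‖y‖ ^ 2 * √(1 + 2 * M / ‖y‖))) *
    (⟪v, w⟫_ℝ - (2 + M / ‖y‖) / ‖y‖ ^ 2 * (⟪y, v⟫_ℝ * ⟪y, w⟫_ℝ))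

/-- `kRep M y` is symmetric. [cite: Cook2000, §3.2.2 (57)] -/
theorem kRep_symm (M : ℝ) (y v w : E3) : kRep M y v w = kRep M y w v := by
  rw [kRep, kRep, real_inner_comm v w, mul_comm ⟪y, v⟫_ℝ]

/-- **The second fundamental form through the first derivatives of the ambient metric**: for the
slice `y ↦ (0, y)` of the Schwarzschild Kerr–Schild chart with future unit normal `N`,
`K_N(v, w) = ½ ((∂_N g)(w̃, ṽ) − (∂_ṽ g)(N, w̃) − (∂_w̃ g)(ṽ, N))`, `ṽ = (0, v)`, `w̃ = (0, w)`:
`K = g(DN v + Γ(N)(ṽ), w̃)` (`secondFundamentalForm_eq_of_repr`), the Christoffel symbols of the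
first kind `g(Γ(N)(ṽ), w̃) = ½ (∂_ṽ g(N, w̃) + ∂_N g(w̃, ṽ) − ∂_w̃ g(ṽ, N))` (`val_christoffel_const`,
O'Neill 1983, Ch. 3, Prop. 3.13) and `g(DN v, w̃) = −(∂_ṽ g)(N, w̃)` (`bilin_fderiv_sliceNormalRep`).
This is the coordinate formula `K_ij = −α Γ⁰_ij`-type expression of Cook 2000, §2 behind (57).
[cite: ONeill1983, Ch. 3, Prop. 3.13; Ch. 4, Lemma 4.4] -/
theorem secondFundamentalForm_zero_eq_half [Facts] [SliceFacts] {M : ℝ} (hM : 0 ≤ M) {r₀ : ℝ}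
    (y : slice 0 r₀) (v w : E3) :
    (smoothMetric M 0 r₀).secondFundamentalForm 𝓘(ℝ, E3) (sliceEmbed 0 r₀) (sliceNormal M 0 r₀)
        y v w =
      2⁻¹ * (fderiv ℝ (bilin M 0) (E4.ofTimeSpace 0 y) (sliceNormalRep M y) (E4.ofTimeSpace 0 w)
            (E4.ofTimeSpace 0 v)
          - fderiv ℝ (bilin M 0) (E4.ofTimeSpace 0 y) (E4.ofTimeSpace 0 v) (sliceNormalRep M y)
            (E4.ofTimeSpace 0 w)
          - fderiv ℝ (bilin M 0) (E4.ofTimeSpace 0 y) (E4.ofTimeSpace 0 w) (E4.ofTimeSpace 0 v)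
            (sliceNormalRep M y)) := by
  have hy : (y : E3) ≠ 0 := ne_zero_of_mem_slice_zero y
  rw [OpensChart.secondFundamentalForm_eq_of_repr (g := (smoothMetric M 0 r₀).toPseudoRiemannianMetric)
    (G := bilin M 0) (smoothMetric_val M 0 r₀) (f := sliceEmbed 0 r₀) (Φ := E4.ofTimeSpace 0)
    (fun _ ↦ rfl) (sliceNormal_zero_eq M r₀) (hasFDerivAt_ofTimeSpace_zero _).differentiableAt
    (differentiableAt_sliceNormalRep hM hy) (differentiableAt_bilin M 0 _) v w,
    fderiv_ofTimeSpace_zero, fderiv_ofTimeSpace_zero]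
  -- the Christoffel symbols of the first kind: `g(Γ(N)(ṽ), w̃) = ½ K(N, ṽ, w̃)`
  have hΓ := OpensChart.val_christoffel_const (g := (smoothMetric M 0 r₀).toPseudoRiemannianMetric)
    (G := bilin M 0) (sliceEmbed 0 r₀ y) (sliceNormalRep M y) (E4.ofTimeSpace 0 v)
    (E4.ofTimeSpace 0 w)
  have hΓ' : bilin M 0 (E4.ofTimeSpace 0 y) (OpensChart.christoffel
      (smoothMetric M 0 r₀).toPseudoRiemannianMetric (bilin M 0) (sliceEmbed 0 r₀ y)
      (sliceNormalRep M y) (E4.ofTimeSpace 0 v)) (E4.ofTimeSpace 0 w) =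
      2⁻¹ * OpensChart.koszulForm (bilin M 0) (E4.ofTimeSpace 0 y) (sliceNormalRep M y)
        (E4.ofTimeSpace 0 v) (E4.ofTimeSpace 0 w) := hΓ
  -- read the pairing `g_{f y}` as the honest bilinear form `bilin M 0 (0, y)` on `E4`
  show bilin M 0 (E4.ofTimeSpace 0 y) (fderiv ℝ (sliceNormalRep M) y v + OpensChart.christoffel
      (smoothMetric M 0 r₀).toPseudoRiemannianMetric (bilin M 0) (sliceEmbed 0 r₀ y)
      (sliceNormalRep M y) (E4.ofTimeSpace 0 v)) (E4.ofTimeSpace 0 w) = _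
  rw [map_add, add_apply, hΓ', OpensChart.koszulForm_apply, bilin_fderiv_sliceNormalRep hM hy v w]
  ring

-- the closing `field_simp`/`ring` normalisation handles a moderately large rational expression
set_option maxHeartbeats 400000 in
/-- **The tensor `k` of the Schwarzschild data `Kerr.data M 0 r₀`** (the second fundamental form
of the Kerr–Schild slice `{t* = 0}` w.r.t. the future unit normal, convention
`K(v, w) = +g(D_v ν, df w)`) in closed form:
`k_y(v, w) = −(2M / (r² √(1 + 2M/r))) (⟪v, w⟫ − (2 + M/r) ⟪y, v⟫⟪y, w⟫ / r²) = kRep M y v w`.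
Cook, Living Rev. Relativ. 3 (2000) 5, §3.2.2, (57); García-Parrado–Valiente Kroon 2008, §5.
[cite: Cook2000, §3.2.2 (57)] -/
theorem data_k_zero_apply [Facts] [SliceFacts] (M : ℝ) (hM : 0 ≤ M) {r₀ : ℝ} (y : slice 0 r₀)
    (v w : E3) : (data M 0 r₀ hM).k y v w = kRep M y v w := by
  have hy : (y : E3) ≠ 0 := ne_zero_of_mem_slice_zero y
  have hr : ‖(y : E3)‖ ≠ 0 := norm_ne_zero_iff.2 hy
  have hsp : E4.spatial (E4.ofTimeSpace 0 (y : E3)) ≠ 0 := by rwa [E4.spatial_ofTimeSpace]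
  have hS : √(1 + 2 * M / ‖(y : E3)‖) ≠ 0 :=
    (Real.sqrt_pos.2 (by have := norm_pos_of_mem_slice_zero y; positivity)).ne'
  rw [data_k, sliceK_apply, secondFundamentalForm_zero_eq_half hM y v w]
  have h1 : ⟪v, (y : E3)⟫_ℝ = ⟪(y : E3), v⟫_ℝ := real_inner_comm _ _
  have h2 : ⟪w, (y : E3)⟫_ℝ = ⟪(y : E3), w⟫_ℝ := real_inner_comm _ _
  have h3 : ⟪w, v⟫_ℝ = ⟪v, w⟫_ℝ := real_inner_comm _ _
  simp only [fderiv_bilin_zero_apply M hsp, bilinZeroDeriv_apply, nullCovectorZero_apply,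
    nullCovectorZeroDeriv_apply, E4.spatial_ofTimeSpace, E4.ofTimeSpace_apply_zero,
    sliceNormalRep_apply_zero M hy, spatial_sliceNormalRep M hy, inner_smul_left, inner_smul_right,
    real_inner_self_eq_norm_sq, kRep]
  simp only [h1, h2, h3, conj_trivial]
  field_simp
  ring

end Kerr

end Literature.Geometry.Lorentzian

end
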